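import Summits.AnomalousDissipation.AnomalousDissipation.Theorems.SolenoidalFractalHomogenisationLagrangianStepVmodFrameDefsJ
import HarnessLib

/-!
# K1L_D (stmt-AnomalousDissipation-27980), (ℓ3-A) road A: TEXT AMENDMENT 2 «v3A» — the frame-smoothness token (F6) `IsFrameRegular6` and the
# cascade token `nC ≤ ϱ₁·(ν/K)^{4/3}·n` threaded into the J-cut texts (RULINGS D28-22 (2), D28-22′; lead g7 15:03:31Z)
(Summits-side definitions file of route `SolenoidalFractalHomogenisation`; review lane; prover ad-k1loc-p3 g11.  The landed `…VmodFrameDefsJ`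
(`IsFrameRegular`, v3 texts) stays byte-identical; this file only ADDS.)

PICK (D28-22′, «A or F6 — say today»): **(F6) FINITE ORDER SIX.**  `IsFrameRegular6 θ Tw nC G J` := the `IsFrameRegular.derivBound` bytes with
`l.length ≤ 2 ↦ l.length ≤ 6` (graded sup bounds `|∂^l G| ≤ θ·nC^{|l|}`, `|∂^l J| ≤ 2θ·nC^{|l|}`, `1 ≤ |l| ≤ 6`, geometric constant absorbed in
`nC`; joint continuity of all words is already `IsFrameRegular.jointCont(G)`).  Reasons: the consumers ((G2)(iii) class-index tails) close with
`j ≥ 6` label derivatives on the square tower (p5 F-p5g16-5); the instance side is a FINITE Grönwall/Faà-di-Bruno tower (twin of `…FrameSecondGradient`),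
no analytic machinery and no factorial convention; the predicate is one token.

TEXTS v3A = v3 (J-cut) VERBATIM except two INSERTED binders (nothing replaced, so the weakenings are pure binder drops):
(i) after `nC ≤ ϱ₁ * n →` the cascade token `nC ≤ ϱ₁ * (ν / K) ^ (4 / 3 : ℝ) * n →` (lead g7 15:03:31Z, from `PieceTK`'s binder `hKr`:
`K·r^{1/4} ≤ r·ν ⇔ r ≤ (ν/K)^{4/3}`, `nC = ϱ·N m = ϱ·r·N(m+1)`; the old binder is KEPT so that `…JA_of_…J` needs no sign facts about `ν/K`);
(ii) after `IsFrameRegular θ Tw nC G J →` the token `IsFrameRegular6 θ Tw nC G J →`.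
* `IsFrameRegular6`, `isFrameRegular6_one`, `IsFrameRegular6.mono`, `IsFrameRegular6.derivBound_le_two`;
* `BlockBoundGJA`, `NearMultGJA`, `SlowVectorClauseModECW0FJA`; weakenings `blockBoundGJA_of_blockBoundGJ`, `nearMultGJA_of_nearMultGJ`,
  `modECW0FJA_of_modECW0FJ` (hence `… _of_modECW0FS` by `modECW0FJ_of_modECW0FS`).
Definitions + trivial lemmas only; NOT a proof of any block, of K1L_D or of AD; rung F-D1.A0.
-/

set_option linter.dupNamespace false

noncomputable section

namespace Summit.AnomalousDissipation.AnomalousDissipation.Theorems.SolenoidalFractalHomogenisation.LagrangianStep.VmodDist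

open Literature.Analysis Literature.Analysis.FluidPDE Literature.Analysis.FunctionSpaces
open MeasureTheory Set Filter UnitAddTorus
open scoped ENNReal NNReal InnerProductSpace
open Summit.AnomalousDissipation.AnomalousDissipation.Theorems.SolenoidalFractalHomogenisation.LagrangianStep.CellClauseMod
open Summit.AnomalousDissipation.AnomalousDissipation.Theorems.SolenoidalFractalHomogenisation.LagrangianStep.LossCurrency
open Summit.AnomalousDissipation.AnomalousDissipation.Theorems.SolenoidalFractalHomogenisation.LagrangianStep.VmodFlat (IsSlow IsFast)

/-! ## §1 The frame-smoothness token (F6) -/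

/-- **`IsFrameRegular6 θ Tw nC G J` — graded sup bounds of the `y`-derivatives of `G` and `J` up to ORDER SIX on the window** (the (R-L24-2) token,
form (F6) of D28-22′): `|∂^l G(t,·)_{ij}| ≤ θ·nC^{|l|}` and `|∂^l J(t,·)_{ij}| ≤ 2θ·nC^{|l|}` for every word `1 ≤ |l| ≤ 6`. -/
structure IsFrameRegular6 (θ Tw nC : ℝ) (G J : ℝ → UnitAddTorus (Fin 3) → Matrix (Fin 3) (Fin 3) ℝ) : Prop where
  /-- graded sup bounds on the first six `y`-derivatives of `G` and `J` on the window -/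
  derivBound6 : ∀ t ∈ Set.Icc 0 Tw, ∀ y i j (l : List (Fin 3)), 1 ≤ l.length → l.length ≤ 6 →
    |Torus.iterPartialDeriv l (fun y => G t y i j) y| ≤ θ * nC ^ l.length ∧
    |Torus.iterPartialDeriv l (fun y => J t y i j) y| ≤ 2 * θ * nC ^ l.length

/-- **Degenerate instance** (certifier probe (P1)): the identity frame with itself as inverse satisfies (F6) at `θ = 0`. -/
theorem isFrameRegular6_one {Tw nC : ℝ} :
    IsFrameRegular6 0 Tw nC (fun _ _ => (1 : Matrix (Fin 3) (Fin 3) ℝ)) (fun _ _ => (1 : Matrix (Fin 3) (Fin 3) ℝ)) where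
  derivBound6 := fun t _ y i j l hl _ => by
    have hl' : l ≠ [] := by rintro rfl; simp at hl
    rw [iterPartialDeriv_const_matrix _ l y, if_neg hl']
    simp

/-- The first two orders of (F6) are the `derivBound` clause of `IsFrameRegular` (same bytes, `≤ 2`). -/
theorem IsFrameRegular6.derivBound_le_two {θ Tw nC : ℝ} {G J : ℝ → UnitAddTorus (Fin 3) → Matrix (Fin 3) (Fin 3) ℝ}
    (h : IsFrameRegular6 θ Tw nC G J) :
    ∀ t ∈ Set.Icc 0 Tw, ∀ y i j (l : List (Fin 3)), 1 ≤ l.length → l.length ≤ 2 →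
      |Torus.iterPartialDeriv l (fun y => G t y i j) y| ≤ θ * nC ^ l.length ∧
      |Torus.iterPartialDeriv l (fun y => J t y i j) y| ≤ 2 * θ * nC ^ l.length :=
  fun t ht y i j l h1 h2 => h.derivBound6 t ht y i j l h1 (h2.trans (by norm_num))

/-- (F6) is monotone in `(θ, nC)` (for the head's `max`-instantiation, cf. `IsFrameRegular.mono`). -/
theorem IsFrameRegular6.mono {θ θ' Tw nC nC' : ℝ} {G J : ℝ → UnitAddTorus (Fin 3) → Matrix (Fin 3) (Fin 3) ℝ}
    (h : IsFrameRegular6 θ Tw nC G J) (hθ0 : 0 ≤ θ) (hθ : θ ≤ θ') (hnC0 : 0 ≤ nC) (hnC : nC ≤ nC') : IsFrameRegular6 θ' Tw nC' G J where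
  derivBound6 := fun t ht y i j l h1 h2 => by
    obtain ⟨hG, hJ⟩ := h.derivBound6 t ht y i j l h1 h2
    have hp : nC ^ l.length ≤ nC' ^ l.length := pow_le_pow_left₀ hnC0 hnC _
    have hp0 : 0 ≤ nC' ^ l.length := pow_nonneg (hnC0.trans hnC) _
    refine ⟨hG.trans ?_, hJ.trans ?_⟩
    · calc θ * nC ^ l.length ≤ θ * nC' ^ l.length := mul_le_mul_of_nonneg_left hp hθ0
        _ ≤ θ' * nC' ^ l.length := mul_le_mul_of_nonneg_right hθ hp0
    · calc 2 * θ * nC ^ l.length ≤ 2 * θ * nC' ^ l.length := mul_le_mul_of_nonneg_left hp (by positivity)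
        _ ≤ 2 * θ' * nC' ^ l.length := mul_le_mul_of_nonneg_right (by linarith) hp0

/-! ## §2 The texts v3A -/

/-- **`BlockBoundGJA`** — `BlockBoundGJ` VERBATIM with the two inserted binders (cascade token after `nC ≤ ϱ₁ * n →`; `IsFrameRegular6 …` after
`IsFrameRegular …`). -/
def BlockBoundGJA {k : ℕ} (W : LatticeShear.LatticeWord k) (M : ℝ) (hM : 0 < M) (c : ℝ)
    (Φ : ℝ → Torus.Visc4 (Fin 3) → Torus.Visc4 (Fin 3)) (lo hi Λ β σ Cb ν₀ K θ₁ ϱ₁ : ℝ) (Px Pφ : ℕ → V2 → Prop) : Prop :=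
  ∀ ν, ∀ hν : ν ∈ Set.Ioo 0 ν₀, ∀ n : ℕ, (⌈K / ν⌉₊ : ℝ) ≤ n → ∀ 𝔸 : Torus.Visc4 (Fin 3),
    Torus.OddSmall 𝔸 (ν * β) → (∃ lam ∈ Set.Icc (1:ℝ) Λ, Torus.NearIso 𝔸 (ν * (lo / lam)) (ν * (hi * lam))) →
    Torus.OddSmall (Φ ν ((1 / ν) • 𝔸)) β → (∃ lam ∈ Set.Icc (1:ℝ) Λ, Torus.NearIso (Φ ν ((1 / ν) • 𝔸)) (lo / lam) (hi * lam)) →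
    ∀ θ ∈ Set.Icc 0 θ₁, ∀ nC : ℝ, 0 ≤ nC → nC ≤ ϱ₁ * n → nC ≤ ϱ₁ * (ν / K) ^ (4 / 3 : ℝ) * n → ∀ Tw > (0:ℝ),
    ∀ G : ℝ → UnitAddTorus (Fin 3) → Matrix (Fin 3) (Fin 3) ℝ, IsFrameModulation θ Tw nC G →
    ∀ J : ℝ → UnitAddTorus (Fin 3) → Matrix (Fin 3) (Fin 3) ℝ, IsFrameRegular θ Tw nC G J → IsFrameRegular6 θ Tw nC G J →
    ∀ U T : ℝ → ℝ → (V2 →L[ℝ] V2),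
      IsDistortedPropagatorS Tw ((1 / (n:ℝ) ^ 2) • 𝔸) (cellField W M hM ν hν.1 n) G U →
      IsDistortedPropagatorS Tw ((1 / (n:ℝ) ^ 2) • (𝔸 + (c / ν) • Φ ν ((1 / ν) • 𝔸))) (fun _ _ => 0) G T →
    ∀ t : ℝ, 0 < t → t ≤ Tw → ∀ x φ : V2, Px n x → Pφ n φ → Torus.IsWeaklyDivFree ((φ : V2) : VF) →
      |⟪U 0 t x - T 0 t x, corrTest (J t) φ⟫_ℝ|
        ≤ (Cb * (Cb * (ν ^ σ + ((⌈K / ν⌉₊ : ℝ) / n) ^ σ + θ ^ σ + (nC / n) ^ σ) + (min 1 ((M * W.period / ν) / t)) ^ σ))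
          * Real.sqrt (lossFwd (T 0 t) x) * Real.sqrt (lossAdj (T 0 t) (corrTest (J t) φ))

/-- **`NearMultGJA`** — `NearMultGJ` VERBATIM with the two inserted binders. -/
def NearMultGJA (c : ℝ) (Φ : ℝ → Torus.Visc4 (Fin 3) → Torus.Visc4 (Fin 3)) (lo hi Λ β ν₀ K θ₁ ϱ₁ κ : ℝ) : Prop :=
  ∀ ν : ℝ, ν ∈ Set.Ioo 0 ν₀ → ∀ n : ℕ, (⌈K / ν⌉₊ : ℝ) ≤ n → ∀ 𝔸 : Torus.Visc4 (Fin 3),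
    Torus.OddSmall 𝔸 (ν * β) → (∃ lam ∈ Set.Icc (1:ℝ) Λ, Torus.NearIso 𝔸 (ν * (lo / lam)) (ν * (hi * lam))) →
    Torus.OddSmall (Φ ν ((1 / ν) • 𝔸)) β → (∃ lam ∈ Set.Icc (1:ℝ) Λ, Torus.NearIso (Φ ν ((1 / ν) • 𝔸)) (lo / lam) (hi * lam)) →
    ∀ θ ∈ Set.Icc 0 θ₁, ∀ nC : ℝ, 0 ≤ nC → nC ≤ ϱ₁ * n → nC ≤ ϱ₁ * (ν / K) ^ (4 / 3 : ℝ) * n → ∀ Tw > (0:ℝ),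
    ∀ G : ℝ → UnitAddTorus (Fin 3) → Matrix (Fin 3) (Fin 3) ℝ, IsFrameModulation θ Tw nC G →
    ∀ J : ℝ → UnitAddTorus (Fin 3) → Matrix (Fin 3) (Fin 3) ℝ, IsFrameRegular θ Tw nC G J → IsFrameRegular6 θ Tw nC G J →
    ∀ T : ℝ → ℝ → (V2 →L[ℝ] V2),
      IsDistortedPropagatorS Tw ((1 / (n:ℝ) ^ 2) • (𝔸 + (c / ν) • Φ ν ((1 / ν) • 𝔸))) (fun _ _ => 0) G T →
    ∀ t : ℝ, 0 < t → t ≤ Tw →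
      (∀ xs xf : V2, IsSlow n xs → IsFast n xf →
        |⟪T 0 t xs, T 0 t xf⟫_ℝ| ≤ κ * Real.sqrt (lossFwd (T 0 t) xs) * Real.sqrt (lossFwd (T 0 t) xf)) ∧
      (∀ φs φf : V2, IsSlow n φs → IsFast n φf →
        Torus.IsWeaklyDivFree ((φs : V2) : VF) → Torus.IsWeaklyDivFree ((φf : V2) : VF) →
        |⟪corrTest (J t) φs, corrTest (J t) φf⟫_ℝ
            - ⟪ContinuousLinearMap.adjoint (T 0 t) (corrTest (J t) φs), ContinuousLinearMap.adjoint (T 0 t) (corrTest (J t) φf)⟫_ℝ|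
          ≤ κ * Real.sqrt (lossAdj (T 0 t) (corrTest (J t) φs)) * Real.sqrt (lossAdj (T 0 t) (corrTest (J t) φf)))

/-- **(V_modECW0FJA)** — `SlowVectorClauseModECW0FJ` VERBATIM with the two inserted binders; the clause the v3A assembly hands to the head
`vmod_EXK_of_VRH0FJA` (lead g7). [cite: ArmstrongVicol2025, §4.1 (PDF p. 34)] -/
def SlowVectorClauseModECW0FJA {k : ℕ} (W : LatticeShear.LatticeWord k) (M : ℝ) (hM : 0 < M) (c : ℝ)
    (Φ : ℝ → Torus.Visc4 (Fin 3) → Torus.Visc4 (Fin 3)) (lo hi Λ β σ C ν₀ K θ₁ ϱ₁ : ℝ) : Prop :=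
  ∀ ν, ∀ hν : ν ∈ Set.Ioo 0 ν₀, ∀ n : ℕ, (⌈K / ν⌉₊ : ℝ) ≤ n → ∀ 𝔸 : Torus.Visc4 (Fin 3),
    Torus.OddSmall 𝔸 (ν * β) → (∃ lam ∈ Set.Icc (1:ℝ) Λ, Torus.NearIso 𝔸 (ν * (lo / lam)) (ν * (hi * lam))) →
    Torus.OddSmall (Φ ν ((1 / ν) • 𝔸)) β → (∃ lam ∈ Set.Icc (1:ℝ) Λ, Torus.NearIso (Φ ν ((1 / ν) • 𝔸)) (lo / lam) (hi * lam)) →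
    ∀ θ ∈ Set.Icc 0 θ₁, ∀ nC : ℝ, 0 ≤ nC → nC ≤ ϱ₁ * n → nC ≤ ϱ₁ * (ν / K) ^ (4 / 3 : ℝ) * n → ∀ Tw > (0:ℝ),
    ∀ G : ℝ → UnitAddTorus (Fin 3) → Matrix (Fin 3) (Fin 3) ℝ, IsFrameModulation θ Tw nC G →
    ∀ J : ℝ → UnitAddTorus (Fin 3) → Matrix (Fin 3) (Fin 3) ℝ, IsFrameRegular θ Tw nC G J → IsFrameRegular6 θ Tw nC G J →
    ∀ U T : ℝ → ℝ → (V2 →L[ℝ] V2),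
      IsDistortedPropagatorS Tw ((1 / (n:ℝ) ^ 2) • 𝔸) (cellField W M hM ν hν.1 n) G U →
      IsDistortedPropagatorS Tw ((1 / (n:ℝ) ^ 2) • (𝔸 + (c / ν) • Φ ν ((1 / ν) • 𝔸))) (fun _ _ => 0) G T →
    ∀ t : ℝ, 0 < t → t ≤ Tw → ∀ x ζ : V2,
      |⟪U 0 t x - T 0 t x, ζ⟫_ℝ|
        ≤ (C * (C * (ν ^ σ + ((⌈K / ν⌉₊ : ℝ) / n) ^ σ + θ ^ σ + (nC / n) ^ σ) + (min 1 ((M * W.period / ν) / t)) ^ σ))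
          * Real.sqrt (lossFwd (T 0 t) x) * Real.sqrt (lossAdj (T 0 t) ζ)

/-! ## §3 Weakenings (pure binder drops: superseded-by-WEAKER certificates) -/

/-- `BlockBoundGJ → BlockBoundGJA`. -/
theorem blockBoundGJA_of_blockBoundGJ {k : ℕ} {W : LatticeShear.LatticeWord k} {M : ℝ} {hM : 0 < M} {c : ℝ}
    {Φ : ℝ → Torus.Visc4 (Fin 3) → Torus.Visc4 (Fin 3)} {lo hi Λ β σ Cb ν₀ K θ₁ ϱ₁ : ℝ} {Px Pφ : ℕ → V2 → Prop}
    (h : BlockBoundGJ W M hM c Φ lo hi Λ β σ Cb ν₀ K θ₁ ϱ₁ Px Pφ) : BlockBoundGJA W M hM c Φ lo hi Λ β σ Cb ν₀ K θ₁ ϱ₁ Px Pφ :=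
  fun ν hν n hn 𝔸 hodd hwin hΦo hΦw θ hθ nC hnC0 hnC _ Tw hTw G hG J hJ _ U T hU hT =>
    h ν hν n hn 𝔸 hodd hwin hΦo hΦw θ hθ nC hnC0 hnC Tw hTw G hG J hJ U T hU hT

/-- `NearMultGJ → NearMultGJA`. -/
theorem nearMultGJA_of_nearMultGJ {c : ℝ} {Φ : ℝ → Torus.Visc4 (Fin 3) → Torus.Visc4 (Fin 3)} {lo hi Λ β ν₀ K θ₁ ϱ₁ κ : ℝ}
    (h : NearMultGJ c Φ lo hi Λ β ν₀ K θ₁ ϱ₁ κ) : NearMultGJA c Φ lo hi Λ β ν₀ K θ₁ ϱ₁ κ :=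
  fun ν hν n hn 𝔸 hodd hwin hΦo hΦw θ hθ nC hnC0 hnC _ Tw hTw G hG J hJ _ T hT =>
    h ν hν n hn 𝔸 hodd hwin hΦo hΦw θ hθ nC hnC0 hnC Tw hTw G hG J hJ T hT

/-- `ModECW0FJ → ModECW0FJA`. -/
theorem modECW0FJA_of_modECW0FJ {k : ℕ} {W : LatticeShear.LatticeWord k} {M : ℝ} {hM : 0 < M} {c : ℝ}
    {Φ : ℝ → Torus.Visc4 (Fin 3) → Torus.Visc4 (Fin 3)} {lo hi Λ β σ C ν₀ K θ₁ ϱ₁ : ℝ}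
    (h : SlowVectorClauseModECW0FJ W M hM c Φ lo hi Λ β σ C ν₀ K θ₁ ϱ₁) : SlowVectorClauseModECW0FJA W M hM c Φ lo hi Λ β σ C ν₀ K θ₁ ϱ₁ :=
  fun ν hν n hn 𝔸 hodd hwin hΦo hΦw θ hθ nC hnC0 hnC _ Tw hTw G hG J hJ _ U T hU hT =>
    h ν hν n hn 𝔸 hodd hwin hΦo hΦw θ hθ nC hnC0 hnC Tw hTw G hG J hJ U T hU hT

/-- `ModECW0FS → ModECW0FJA` (through `modECW0FJ_of_modECW0FS`). -/
theorem modECW0FJA_of_modECW0FS {k : ℕ} {W : LatticeShear.LatticeWord k} {M : ℝ} {hM : 0 < M} {c : ℝ}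
    {Φ : ℝ → Torus.Visc4 (Fin 3) → Torus.Visc4 (Fin 3)} {lo hi Λ β σ C ν₀ K θ₁ ϱ₁ : ℝ}
    (h : SlowVectorClauseModECW0FS W M hM c Φ lo hi Λ β σ C ν₀ K θ₁ ϱ₁) : SlowVectorClauseModECW0FJA W M hM c Φ lo hi Λ β σ C ν₀ K θ₁ ϱ₁ :=
  modECW0FJA_of_modECW0FJ (modECW0FJ_of_modECW0FS h)

end Summit.AnomalousDissipation.AnomalousDissipation.Theorems.SolenoidalFractalHomogenisation.LagrangianStep.VmodDist

end
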